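import Literature.NumberTheory.Transcendental.KZCubeRationalMoves

/-!
# `ReductionRigidity` (stmt-KontsevichZagierPeriods-3407), line `Sketch` (Padé box island, `w = 2`):
# stub `stub_eulerDescent`

THE EULER (POLE-ORDER) DESCENT on the closed unit square `□² = [0,1]²`, `N ≥ 2`. With
`h = q·x^a y^b/(N − xy)^{m+1}` one has, pointwise on the square,

  `∂_y (y·h) = (b + 1)·h + (m + 1)·h·xy/(N − xy) = (b − m)·h + N(m + 1)·q·x^a y^b/(N − xy)^{m+2}`

(because `xy/(N − xy) = N/(N − xy) − 1`). Hence

  `q·x^a y^b/(N − xy)^{m+2} = ∂_y T + (q(m − b)/(N(m+1)))·x^a y^b/(N − xy)^{m+1}`,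
  `T = (q/(N(m+1)))·x^a y^{b+1}/(N − xy)^{m+1}`,

a regular rational function on the closed square (`KZ.RFun 2`). ONE Stokes move along the last
coordinate `y` (`KZ.RFun.stokes`, Ayoub's relation, an instance of rule (3)) replaces `[□², ∂_y T]`
by its faces: `y = 1` gives `[□¹, (q/(N(m+1)))·x^a/(N − x)^{m+1}]`, `y = 0` gives the zero
integrand (factor `y^{b+1}`), a relation. Integrand additivity (rule (1)) assembles the registered
congruence

  `[q x^a y^b/(N−xy)^{m+2}] ≡ [q/(N(m+1))·x^a/(N−x)^{m+1}]₁`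
  `                            + [q(m−b)/(N(m+1))·x^a y^b/(N−xy)^{m+1}]`

in `KZ.relations`, for ARBITRARY representations `r, r₁, r'` carrying these integrands on the cubes
(bridged to the `RFun` representations by `KZ.of_sub_of_mem_relations_of_eqOn`).
-/

noncomputable section

open MeasureTheory Set MvPolynomial

namespace Summit.KontsevichZagierPeriods.HermiteRigidity.ReductionRigidity

open Literature.NumberTheory.Transcendental
open Literature.NumberTheory.Transcendental.KZ

/-! ## The primitive `T = c·x^a y^{b+1}/(N − xy)^{m+1}` as a regular rational function -/

/-- On the closed unit square, `N − xy ≥ 1` for `N ≥ 2`. [folklore] -/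
theorem eulerDescent_one_le_sub {N : ℕ} (hN : 2 ≤ N) {p : Fin 2 → ℝ} (hp : p ∈ cube 2) :
    (1 : ℝ) ≤ (N : ℝ) - p 0 * p 1 := by
  have h2 : (2 : ℝ) ≤ (N : ℝ) := by exact_mod_cast hN
  have h0 := hp 0
  have h1 := hp 1
  nlinarith [mul_le_one₀ h0.2 h1.1 h1.2, mul_nonneg h0.1 h1.1]

/-- The box denominator `(N − xy)^k` does not vanish on the closed square. [folklore] -/
theorem eulerDescent_boxDen_ne {N : ℕ} (hN : 2 ≤ N) (k : ℕ) :
    ∀ p ∈ cube 2, aeval p ((C (N : ℚ) - X 0 * X 1) ^ k : MvPolynomial (Fin 2) ℚ) ≠ 0 := by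
  intro p hp
  have h := eulerDescent_one_le_sub hN hp
  simp only [map_pow, map_sub, map_mul, aeval_C, aeval_X, eq_ratCast, Rat.cast_natCast]
  exact pow_ne_zero _ (by linarith)

/-- The values of `T = c·x^a y^{b+1}/(N − xy)^{m+1}`. [folklore] -/
theorem eulerDescent_fn (N : ℕ) (c : ℚ) (a b m : ℕ) (T : RFun 2)
    (hTn : T.num = C c * X 0 ^ a * X 1 ^ (b + 1))
    (hTd : T.den = (C (N : ℚ) - X 0 * X 1) ^ (m + 1)) (y : Fin 2 → ℝ) :
    T.fn y = (c : ℝ) * y 0 ^ a * y 1 ^ (b + 1) / ((N : ℝ) - y 0 * y 1) ^ (m + 1) := by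
  simp only [RFun.fn, hTn, hTd, map_mul, map_pow, map_sub, aeval_C, aeval_X, eq_ratCast,
    Rat.cast_natCast]

/-- The quotient-rule derivative `∂_y T` of `T = c·x^a y^{b+1}/(N − xy)^{m+1}` on the closed square:
`∂_y T = c·x^a y^b·((b+1)N + (m−b)xy)/(N − xy)^{m+2}`. [folklore] -/
theorem eulerDescent_dlast_fn {N : ℕ} (hN : 2 ≤ N) (c : ℚ) (a b m : ℕ) (T : RFun 2)
    (hTn : T.num = C c * X 0 ^ a * X 1 ^ (b + 1))
    (hTd : T.den = (C (N : ℚ) - X 0 * X 1) ^ (m + 1)) {p : Fin 2 → ℝ} (hp : p ∈ cube 2) :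
    T.dlast.fn p = (c : ℝ) * (p 0 ^ a * p 1 ^ b) *
      (((b : ℝ) + 1) * (N : ℝ) + ((m : ℝ) - b) * (p 0 * p 1)) /
        ((N : ℝ) - p 0 * p 1) ^ (m + 2) := by
  have hD : (N : ℝ) - p 0 * p 1 ≠ 0 := by
    have h := eulerDescent_one_le_sub hN hp
    exact fun h0 => by linarith
  have h10 : ((1 : Fin 2) : Fin 2) ≠ 0 := by decide
  have hlast : Fin.last 1 = (1 : Fin 2) := rfl
  simp only [RFun.fn, RFun.dlast, hTn, hTd, hlast, pderiv_mul, pderiv_C, pderiv_pow, pderiv_X_self,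
    pderiv_X_of_ne h10.symm, map_sub, map_mul, map_pow, aeval_C, aeval_X, eq_ratCast,
    Rat.cast_natCast, Nat.add_sub_cancel, zero_mul, zero_add, mul_one, mul_zero, zero_sub]
  simp only [map_add, map_neg, map_one, map_natCast, aeval_X, Nat.cast_add, Nat.cast_one]
  field_simp
  ring

/-! ## The descent -/

/-- **Euler descent** (pole-order descent, divided form): with `h = q x^a y^b/(N−xy)^{m+1}`,
`∂_y(y·h) = (b − m)·h + N(m+1)·q x^a y^b/(N−xy)^{m+2}`, so one Stokes move along `y` gives
`[q x^a y^b/(N−xy)^{m+2}] ≡ [q/(N(m+1)) · x^a/(N−x)^{m+1}]₁`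
`                          + [q(m−b)/(N(m+1)) · x^a y^b/(N−xy)^{m+1}]`
in `KZ.relations`, for all representations carrying these integrands on the closed cubes.
[cite: KontsevichZagier2001, §1.2 rule (3)] -/
theorem stub_eulerDescent : ∀ (N : ℕ), 2 ≤ N → ∀ (q : ℚ) (a b m : ℕ)
    (r : IntegralRep 2) (r₁ : IntegralRep 1) (r' : IntegralRep 2),
    r.domain = cube 2 →
    EqOn r.integrand (fun p => (q : ℝ) * (p 0 ^ a * p 1 ^ b) / ((N : ℝ) - p 0 * p 1) ^ (m + 2)) (cube 2) →
    r₁.domain = cube 1 →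
    EqOn r₁.integrand
      (fun p => ((q / ((N : ℚ) * ((m : ℚ) + 1)) : ℚ) : ℝ) * p 0 ^ a / ((N : ℝ) - p 0) ^ (m + 1)) (cube 1) →
    r'.domain = cube 2 →
    EqOn r'.integrand
      (fun p => ((q * ((m : ℚ) - b) / ((N : ℚ) * ((m : ℚ) + 1)) : ℚ) : ℝ) * (p 0 ^ a * p 1 ^ b) /
        ((N : ℝ) - p 0 * p 1) ^ (m + 1)) (cube 2) →
    KZ.of r - (KZ.of r₁ + KZ.of r') ∈ KZ.relations := by
  intro N hN q a b m r r₁ r' hr hri hr₁ hr₁i hr' hr'i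
  -- the primitive `T = y·h/(N(m+1)) = c·x^a y^{b+1}/(N − xy)^{m+1}`, `c = q/(N(m+1))`
  set c : ℚ := q / ((N : ℚ) * ((m : ℚ) + 1)) with hc
  set T : RFun 2 := ⟨C c * X 0 ^ a * X 1 ^ (b + 1), (C (N : ℚ) - X 0 * X 1) ^ (m + 1),
    eulerDescent_boxDen_ne hN (m + 1)⟩
  have hTn : T.num = C c * X 0 ^ a * X 1 ^ (b + 1) := rfl
  have hTd : T.den = (C (N : ℚ) - X 0 * X 1) ^ (m + 1) := rfl
  have hN0 : (N : ℝ) ≠ 0 := by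
    have h2 : (2 : ℝ) ≤ (N : ℝ) := by exact_mod_cast hN
    exact fun h0 => by linarith
  have hm0 : (m : ℝ) + 1 ≠ 0 := by positivity
  -- the Stokes move along `y` (the last coordinate of `Fin 2`)
  have hst := RFun.stokes T
  -- (1) integrand additivity: `r = ∂_y T + r'` on the square
  have e1 : KZ.of r - KZ.of T.dlast.rep - KZ.of r' ∈ KZ.relations := by
    refine integrandAddRel_subset_relations ⟨2, r, T.dlast.rep, r', ?_, ?_, fun p hp => ?_, rfl⟩
    · rw [RFun.rep_domain, hr]
    · rw [hr', hr]
    rw [hr] at hp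
    have hD : (N : ℝ) - p 0 * p 1 ≠ 0 := by
      have h := eulerDescent_one_le_sub hN hp
      exact fun h0 => by linarith
    rw [Pi.add_apply, hri hp, hr'i hp, RFun.rep_integrand,
      eulerDescent_dlast_fn hN c a b m T hTn hTd hp, hc]
    push_cast
    field_simp
    ring
  -- (2) the face `y = 1` is `r₁`
  have e2 : KZ.of (T.face 1 ⟨zero_le_one, le_rfl⟩).rep - KZ.of r₁ ∈ KZ.relations := by
    refine KZ.of_sub_of_mem_relations_of_eqOn (by rw [hr₁, RFun.rep_domain]) fun x _ => ?_
    rw [RFun.rep_domain] at *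
    show (T.face 1 ⟨zero_le_one, le_rfl⟩).fn x = r₁.integrand x
    rw [hr₁i (by assumption), RFun.fn_face, eulerDescent_fn N c a b m T hTn hTd, hc]
    simp [Fin.snoc]
  -- (3) the face `y = 0` vanishes
  have e3 : KZ.of (T.face 0 ⟨le_rfl, zero_le_one⟩).rep ∈ KZ.relations := by
    refine RFun.rel_of_eqOn_zero fun x _ => ?_
    rw [RFun.fn_face, eulerDescent_fn N c a b m T hTn hTd]
    simp [Fin.snoc]
  have : KZ.of r - (KZ.of r₁ + KZ.of r') =
      (KZ.of r - KZ.of T.dlast.rep - KZ.of r') +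
      (KZ.of T.dlast.rep - (KZ.of (T.face 1 ⟨zero_le_one, le_rfl⟩).rep -
        KZ.of (T.face 0 ⟨le_rfl, zero_le_one⟩).rep)) +
      (KZ.of (T.face 1 ⟨zero_le_one, le_rfl⟩).rep - KZ.of r₁) -
      KZ.of (T.face 0 ⟨le_rfl, zero_le_one⟩).rep := by abel
  rw [this]
  exact KZ.relations.sub_mem (KZ.relations.add_mem (KZ.relations.add_mem e1 hst) e2) e3

end Summit.KontsevichZagierPeriods.HermiteRigidity.ReductionRigidity
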